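import Literature.Topology.FourManifolds.TopPoincareFiveLeEngulfing
import Literature.Topology.FourManifolds.SkeletalCompression
import HarnessLib

/-!
# S14 from the Topological Engulfing Theorem 4.12.1 stated with `MonotoneConn`

`TopPoincareFiveLeEngulfing.lean` reduces the named fact
`Literature.Topology.FourManifolds.nonempty_homeomorph_sphere_of_five_le` (spc4.S14, the
topological generalized Poincaré theorem in dimensions `n ≥ 5`) to Rushing's Topological
Engulfing Theorem 4.12.1 for connected manifolds as types
(`nonempty_homeomorph_sphere_of_five_le_of_engulfing_manifold`), with Rushing's hypothesis
"`(M, U)` monotonically `(n - 3)`-connected" in the *disc form* `MonotonicallyConnected`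
(`RelativeConnectivity.lean`).  The engulfing induction consumes that hypothesis in the
*compression form* `MonotoneConn` (`Compressible.lean`: maps of finite simplicial pairs of
relative dimension `≤ r` compress rel the subcomplex), and the compression lemma
`MonotonicallyConnected.monotoneConn` (`SkeletalCompression.lean`) converts the former into the
latter.  Hence S14 also follows from Theorem 4.12.1 stated with `MonotoneConn` — the form of
the hypothesis which a formalisation of Rushing's proof consumes directly
(`nonempty_homeomorph_sphere_of_five_le_of_engulfing_monotoneConn`).

Everything is proved; no definition, no named fact.

## References

* T. B. Rushing, *Topological embeddings*, Academic Press (1973), Thm. 4.12.1 (p. 201) and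
  Cor. 4.13.2. [Rushing1973]
* A. Hatcher, *Algebraic Topology*, Cambridge Univ. Press (2002), §4.1 Lemma 4.6.
  [HatcherAT2002]
-/

open Set Function Metric Topology

noncomputable section

namespace Literature.Topology.FourManifolds

universe u in
/-- **spc4.S14 from the Topological Engulfing Theorem 4.12.1, compression form of the
hypothesis.** IF, for every `n ≥ 5` and every connected, Hausdorff, second-countable
topological `n`-manifold `N : Type`, every open `U ⊆ N` with `(N, U)` monotonely
`(n - 3)`-compressible (`MonotoneConn (n - 3) U`: every compact `C₁ ⊆ U` lies in a closed
`C₂ ⊆ U` such that maps of finite simplicial pairs of relative dimension `≤ n - 3` into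
`(N ∖ C₂, U ∖ C₂)` compress rel the subcomplex) engulfs, after a compactly supported
homeomorphism of `N` fixing a prescribed compact `C ⊆ U`, every compact polyhedron of
dimension `≤ n - 3` read through an open chart `e : ℝⁿ → N` — Rushing's Theorem 4.12.1
`(M, U, f(P) = e(|T|), Q = ∅, R = P, C, E, e₁)` — THEN the named fact
`Literature.Topology.FourManifolds.nonempty_homeomorph_sphere_of_five_le` holds in every
universe: `nonempty_homeomorph_sphere_of_five_le_of_engulfing_manifold` with
`MonotonicallyConnected.monotoneConn`. [cite: Rushing1973, Thm. 4.12.1 and Cor. 4.13.2] -/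
theorem nonempty_homeomorph_sphere_of_five_le_of_engulfing_monotoneConn
    (hTL : ∀ (n : ℕ), 5 ≤ n → ∀ (N : Type) [TopologicalSpace N] [T2Space N]
      [SecondCountableTopology N] [ChartedSpace (EuclideanSpace ℝ (Fin n)) N] [ConnectedSpace N],
      ∀ U : Set N, IsOpen U → MonotoneConn (n - 3) U →
      ∀ (e : EuclideanSpace ℝ (Fin n) → N), IsOpenEmbedding e →
      ∀ (T : Geometry.SimplicialComplex ℝ (EuclideanSpace ℝ (Fin n))), T.faces.Finite →
        (∀ F ∈ T.faces, F.card ≤ n - 2) →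
      ∀ C : Set N, IsCompact C → C ⊆ U →
        ∃ g : N ≃ₜ N, (∃ K : Set N, IsCompact K ∧ ∀ y, y ∉ K → g y = y) ∧
          (∀ y ∈ C, g y = y) ∧ e '' T.space ⊆ g '' U) :
    nonempty_homeomorph_sphere_of_five_le.{u} :=
  nonempty_homeomorph_sphere_of_five_le_of_engulfing_manifold
    fun n hn N _ _ _ _ _ U hU hmono => hTL n hn N U hU hmono.monotoneConn

end Literature.Topology.FourManifolds

end
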